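import Summits.ABC.IUTFork.Joshi.TestThetaLociGenuine
import HarnessLib

/-!
# X-09 at GENUINE DATA, sequel (R-J census row Y-11) — ONE (Ind2) mover of the unit ball at ONE finite place moves the Θ-pilot
# region of `settingPrVolSharp` at EVERY label with unit label idele over that prime (label `0` always; every label of `𝔽_l^⋇`
# off `S`) — so the ⊇-half of print's «are» FAILS for every Θ-inside reading at those slots, and rp-h3's `OrbitInside` fails

Proof-only sequel (0 definitions, 0 `Prop` facts, no `sorry`; abc-iut cell, block E / R-J census, rung LADDER-ABC:A2.E; seat
abc-iut-E-t22, gen 8) of `Joshi/TestThetaLociGenuine.lean` (this seat: the D-11 rows of p429683 at abc-iut-c312-7's genuine sharp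
setting per reading; its negatives for [J-III] Thm-Def 9.8.1.1 (7) «are Mochizuki's multi-radial representations» used abc-iut-rp-h3's
tame-quadratic parity mover at the labels of `𝔽_l^⋇` and abc-iut-w5-d044's mover at the label `0`). THIS FILE removes the
«label-`0` only» / «tame quadratically ramified `p₀ ≥ 5`» dichotomy: abc-iut-E-t44's integral-pure-tensor argument
(`Joshi/TestGenuinePinsVacuity.lean` p445249, label `0`) runs VERBATIM at every label `j` whose label idele over the prime `p` is a
unit at every place `x | p` — the sharp Θ-box at the summand `v⃗` is then `ι_j(u)·(R_I)^∼` with `‖u‖ = 1`, and a pure tensor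
`⊗_a w_a` lies in it iff `Π_a ‖w_a(v⃗ a)‖ ≤ 1` (rp-h3 `purePacket_mem_iota_smul_normalizedPacket_iff`, [IUTchIV] Prop. 1.4 (i)).
So if at ONE place `v₀ | p` ONE `g₀ ∈ Real.ismDH logv v₀` (Dupuy–Hilado's (Ind2): all bicontinuous `ℚ`-linear automorphisms of
`K_{v₀}` mapping the log-shell onto itself, arXiv:2004.13228 §4.9) carries ONE local integer `x₀` out of the unit ball, the (Ind2)-family
`⊗_a (⊕_v G_v)` (`G_{v₀} = g₀`, identity elsewhere — at every slot) carries `⊗_a δ_{v₀} x₀ ∈ 𝒪_𝕃(−P_Θ)_{j,p}` to a point whose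
coordinates at the diagonal summand `(v₀,…,v₀)` have norm `‖g₀ x₀‖^{|S_{j+1}|} > 1`, outside the region:

* `exists_ind2Family_moves_thetaRegion_settingPrVolSharp_of_unit_label` (criterion form `‖x₀‖ ≤ 1 < ‖g₀ x₀‖`, any label with unit
  label idele over `p`), `…_of_image_integers_ne` (ball form `ψ '' 𝒪_{v₀} ≠ 𝒪_{v₀}`: `ψ` or `ψ⁻¹` is such a `g₀`, w5-d216
  `NonIsometryMover.symm_mem_ismDH`);
* hence for every Θ-inside reading of Joshi's locus (any loci signature, any dictionary): `¬ PossibleImagesWithinLocus` from a mover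
  over a prime `p` at the label `0` (no hypothesis on `S`; = the parent's `…_of_exists_mover` for general analytic `logv`) and at EVERY
  label of `𝔽_l^⋇` when no place of `S` lies over `p` and the Θ-ideles are units off `S` (abc-iut-c312-7's `ht1`)
  (`not_possibleImagesWithinLocus_settingPrVolSharp_of_mover_labelSucc`); and **`¬ OrbitInside`** there
  (`not_orbitInside_settingPrVolSharp_of_image_integers_ne`) — rp-h3's RP-H32 real-cell exit through (Ind2) now needs only a mover of
  the unit ball off `S` (tame `2 ≤ e ≤ p−2`, w5-d180; dyadic with `√−1 ∈ F`, w5-d039 — the sequel `…GenuineInitial` discharges it at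
  every initial Θ-datum), not a tame quadratically ramified `p₀ ≥ 5`.
**No side is taken** on [IUTchIII] Cor. 3.12 or on any author; typed ≠ proved; R13 «J-FALSE-AT-GENUINE» DATA; HONEST SCOPE: OUR typed
objects (c312-5's `logShellsDH`, DH's (Ind2) as ALL shell-preserving lattice automorphisms, the SHARP (Ind3) reading); under an ISOMETRY
reading of (Ind2) no mover exists and nothing here applies (E-LOCATION attach point A1). [claim: Joshi2024ATS3, status: disputed]
[claim: Mochizuki2012, status: disputed] [cite: DupuyHilado2025, §3.9, §4.9] [cite: Mochizuki2012, IUTchIV Prop. 1.4 (i) p. 13]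
-/

noncomputable section

open Set NumberField IsDedekindDomain
open scoped Pointwise

namespace Summit.ABC.IUTFork.Joshi

open Thm311 Thm311.Real Cor312 Cor312Vol Literature.IUT.LogThetaLattice Literature.IUT.LogVolume Literature.IUT.HodgeTheaters
open Summit.ABC.IUTFork.Repair.CandDupuyHilado32 (OrbitInside)

section Genuine

variable {F : Type} [Field F] [NumberField F] (X : PilotData F) {logv : PadicLogs F} (hlog : LogvAnalytic logv)
  (M : Type) [Field M] [NumberField M]
  (archPk : ∀ (j : (thetaIndex X).Label) (vQ : (thetaIndex X).VQ), Set ((logShellsDH X logv).Packet j vQ))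
  (archSub : ∀ (j : (thetaIndex X).Label) (v : (thetaIndex X).V),
    Set ((logShellsDH X logv).Packet j ((thetaIndex X).over v)))
  (Ψ : ℤ → ∀ v : (thetaIndex X).V, v ∈ (thetaIndex X).Vbad → Set ((logShellsDH X logv).StarPacket v))
  (act : ℤ → ∀ v : (thetaIndex X).V, v ∈ (thetaIndex X).Vbad →
    (logShellsDH X logv).StarPacket v → Module.End ℚ ((logShellsDH X logv).StarPacket v))
  (Mmod : ℤ → ∀ j : (thetaIndex X).LabelStar, Set ((logShellsDH X logv).GlobalPacket j.1))
  (region : ℤ → ∀ j : (thetaIndex X).LabelStar, FinDivisor M → ∀ vQ : (thetaIndex X).VQ,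
    Set ((logShellsDH X logv).Packet j.1 vQ))
  (n : ℤ) {HT : Type} {LogLink : HT → HT → Type} {IsFull : ∀ {s t : HT}, LogLink s t → Prop}
  (lat : LGPGaussianLogThetaLattice LogLink IsFull)
  {Frd : Type} {IsoF : Frd → Frd → Type} {Ob : Frd → Type} {realify : Frd → Frd} {Strip : Type}
  {IsoS : Strip → Strip → Type} {Mv : ∀ v : (thetaIndex X).V, v ∈ (thetaIndex X).Vbad → Type}
  [∀ v h, Monoid (Mv v h)]
  (sig : GlobalLGPFrobenioidSignature (thetaIndex X).lstar (thetaIndex X).V (· ∈ (thetaIndex X).Vbad)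
    Frd IsoF Ob realify Strip IsoS Mv)
  (split : SplittingMonoids Mv) {ObΔ : Type} {N : ∀ v : (thetaIndex X).V, v ∈ (thetaIndex X).Vbad → Type}
  [∀ v h, Monoid (N v h)] (qData : QPilotData ObΔ N)
  (t : ∀ (pp : Nat.Primes) (_ : Fin X.lstar) (x : (thetaIndex X).Fibre (.inr pp)),
    haveI : Fact (pp : ℕ).Prime := ⟨pp.2⟩; kOf X pp.1 x)
  (tq : ∀ (pp : Nat.Primes) (x : (thetaIndex X).Fibre (.inr pp)), haveI : Fact (pp : ℕ).Prime := ⟨pp.2⟩; kOf X pp.1 x)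
  (htq0 : ∀ pp x, tq pp x ≠ 0)
  (htq1 : ∀ (pp : Nat.Primes) (x : (thetaIndex X).Fibre (.inr pp)),
    haveI : Fact (pp : ℕ).Prime := ⟨pp.2⟩; placeOf X pp.1 x ∉ X.S → ‖tq pp x‖ = 1)
  (col : ℤ → Column (logShellsDH X logv))
  {W : Type} {V : W → Type} [∀ w, TopologicalSpace (V w)] {TJ TM : Type} [TopologicalSpace TJ] [TopologicalSpace TM]
  {C : ATS3.TensorPacketLociDatum W V TJ TM}

/-! ## 1. The mover at every label with unit label idele (criterion form) -/

section Criterion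

variable (pp : Nat.Primes) (v₀ : (thetaIndex X).Fibre (.inr pp))
  {g₀ : (logShellsDH X logv).carrier v₀.1 ≃ₗ[ℚ] (logShellsDH X logv).carrier v₀.1} (hg₀ : g₀ ∈ ismDH logv v₀.1)
  {x₀ : (logShellsDH X logv).carrier v₀.1} (hx₀ : haveI : Fact (pp : ℕ).Prime := ⟨pp.2⟩; ‖(presAt X hlog pp).φ v₀ x₀‖ ≤ 1)
  (hgx₀ : haveI : Fact (pp : ℕ).Prime := ⟨pp.2⟩; 1 < ‖(presAt X hlog pp).φ v₀ (g₀ x₀)‖)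

include hg₀ hx₀ hgx₀

/-- **THE (Ind2) Θ-MOVER AT EVERY LABEL WITH UNIT LABEL IDELE, GENUINE DATA.** If at one place `v₀ | p` one `g₀ ∈ Real.ismDH logv v₀`
moves one local integer out of the unit ball, then the (Ind2)-family `⊗_a (⊕_v G_v)` (`G_{v₀} = g₀`, identity elsewhere, at every
slot) — a member of abc-iut-c312-1's `Ind2Family` — carries a point of the `(m, j, p)` Kummer image of the Θ-pilot of
`settingPrVolSharp` OUT of it, at every label `j` whose label idele is a unit at every place over `p` (the integral pure tensor
`⊗_a δ_{v₀} x₀`; E-t44's label-`0` argument p445249 at a general label). [cite: DupuyHilado2025, §3.9, §4.9]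
[cite: Mochizuki2012, IUTchIV Prop. 1.4 (i) p. 13] -/
theorem exists_ind2Family_moves_thetaRegion_settingPrVolSharp_of_unit_label (j : (thetaIndex X).Label)
    (h1 : haveI : Fact (pp : ℕ).Prime := ⟨pp.2⟩; ∀ x : (thetaIndex X).Fibre (.inr pp), ‖labelIdele X t pp j x‖ = 1) (m : ℤ) :
    ∃ Φ ∈ (logShellsDH X logv).Ind2Family,
      ∃ y ∈ (settingPrVolSharp X hlog M archPk archSub Ψ act Mmod region n lat sig split qData tq t htq0 htq1).thetaRegion m j
          (.inr pp),
        Φ j (.inr pp) y ∉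
          (settingPrVolSharp X hlog M archPk archSub Ψ act Mmod region n lat sig split qData tq t htq0 htq1).thetaRegion m j
            (.inr pp) := by
  classical
  haveI : Fact (pp : ℕ).Prime := ⟨pp.2⟩
  haveI : Nonempty ((thetaIndex X).Caps j) := ⟨0⟩
  -- the one-place family: `g₀` at `v₀`, identity at every other place of `F`
  let G : ∀ y : (thetaIndex X).V, (logShellsDH X logv).carrier y ≃ₗ[ℚ] (logShellsDH X logv).carrier y :=
    Function.update (fun y => LinearEquiv.refl ℚ ((logShellsDH X logv).carrier y)) v₀.1 g₀
  have hGv₀ : G v₀.1 = g₀ := by simp only [G, Function.update_self]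
  have hGv : ∀ y, y ≠ v₀.1 → G y = LinearEquiv.refl ℚ _ := fun y hy => by simp only [G, Function.update_of_ne hy]
  have hGmem : ∀ y, G y ∈ ismDH logv y := fun y => by
    by_cases hy : y = v₀.1
    · subst hy; rw [hGv₀]; exact hg₀
    · rw [hGv y hy]; exact refl_mem_ismDH logv y
  let Φ : (logShellsDH X logv).PacketAut := fun j' vQ' =>
    (logShellsDH X logv).factorwise j' vQ' fun _ => (logShellsDH X logv).summandwise vQ' fun w => G w.1
  have hΦ : Φ ∈ (logShellsDH X logv).Ind2Family := fun j' vQ' => ⟨fun _ w => G w.1, fun _ w => hGmem w.1, rfl⟩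
  -- the unit label idele: membership of a pure tensor in the box at `v⃗` reads `Π_a ‖w_a(v⃗ a)‖ ≤ 1`
  have hc0 : ∀ x : (thetaIndex X).Fibre (.inr pp), labelIdele X t pp j x ≠ 0 := fun x h0 => by
    have := h1 x; rw [h0, norm_zero] at this; exact zero_ne_one this
  have hmem : ∀ (e : (thetaIndex X).Caps j → (thetaIndex X).Fibre (.inr pp)) (z : ∀ a, (presAt X hlog pp).kk e a),
      purePacket pp.1 ((presAt X hlog pp).kk e) z ∈
          iota pp.1 ((presAt X hlog pp).kk e) (Fin.last _) (labelIdele X t pp j (e (Fin.last _))) •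
            (normalizedPacket pp.1 ((presAt X hlog pp).kk e) : Set ((presAt X hlog pp).X e)) ↔
        ∏ a, ‖z a‖ ≤ 1 := fun e z => by
    rw [Repair.CandDupuyHilado32RealInd2.purePacket_mem_iota_smul_normalizedPacket_iff pp.1 ((presAt X hlog pp).kk e)
      (Fin.last _) (hc0 _)]
    exact ⟨fun h => h.trans_eq (h1 _), fun h => h.trans_eq (h1 _).symm⟩
  -- the integral pure tensor supported at `v₀` lies in the region
  let y : (thetaIndex X).Caps j → (logShellsDH X logv).Packet1 (.inr pp) := fun _ => Pi.single v₀ x₀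
  have haux : ∀ v : (thetaIndex X).Fibre (.inr pp),
      ‖(presAt X hlog pp).φ v ((Pi.single v₀ x₀ : (logShellsDH X logv).Packet1 (.inr pp)) v)‖ ≤ 1 := by
    intro v
    rcases eq_or_ne v v₀ with rfl | hv
    · rw [Pi.single_eq_same]; exact hx₀
    · rw [Pi.single_eq_of_ne hv, map_zero, norm_zero]; exact zero_le_one
  refine ⟨Φ, hΦ, (logShellsDH X logv).tprod j (.inr pp) y, ?_, fun himg => ?_⟩
  · rw [Repair.CandDupuyHilado32Real.thetaRegion_settingPrVolSharp_inr]
    show (presAt X hlog pp).comparison j (PiTensorProduct.tprod ℚ y) ∈ Set.pi Set.univ _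
    refine Set.mem_univ_pi.mpr fun e => ?_
    rw [PadicPresentation.comparison_tprod]
    exact (hmem e _).mpr (Finset.prod_le_one (fun a _ => norm_nonneg _) fun a _ => haux (e a))
  · -- its image under the move: `⊗_a (G · (δ_{v₀} x₀))`, read at the diagonal summand `(v₀,…,v₀)`
    have hΦy : Φ j (.inr pp) ((logShellsDH X logv).tprod j (.inr pp) y) =
        (logShellsDH X logv).tprod j (.inr pp) fun a => fun w => G w.1 (y a w) :=
      (logShellsDH X logv).factorwise_summandwise_tprod j (.inr pp) (fun _ w => G w.1) y
    rw [hΦy, Repair.CandDupuyHilado32Real.thetaRegion_settingPrVolSharp_inr] at himg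
    have h := Set.mem_univ_pi.mp himg (fun _ => v₀)
    change (presAt X hlog pp).comparison j (PiTensorProduct.tprod ℚ fun a => fun w => G w.1 (y a w)) (fun _ => v₀) ∈ _ at h
    rw [PadicPresentation.comparison_tprod] at h
    have hle := (hmem (fun _ => v₀) _).mp h
    have hle' : ∏ _a : (thetaIndex X).Caps j, ‖(presAt X hlog pp).φ v₀ (g₀ x₀)‖ ≤ 1 := by
      simpa only [y, Pi.single_eq_same, hGv₀] using hle
    rw [Finset.prod_const, Finset.card_univ] at hle'
    exact absurd hle' (not_le.mpr (one_lt_pow₀ hgx₀ Fintype.card_ne_zero))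

/-- … hence that family does NOT map the Θ-region onto itself there (nor into itself). [folklore] -/
theorem exists_ind2Family_image_thetaRegion_ne_settingPrVolSharp_of_unit_label (j : (thetaIndex X).Label)
    (h1 : haveI : Fact (pp : ℕ).Prime := ⟨pp.2⟩; ∀ x : (thetaIndex X).Fibre (.inr pp), ‖labelIdele X t pp j x‖ = 1) (m : ℤ) :
    ∃ Φ ∈ (logShellsDH X logv).Ind1Family ∪ (logShellsDH X logv).Ind2Family,
      Φ j (.inr pp) ''
          (settingPrVolSharp X hlog M archPk archSub Ψ act Mmod region n lat sig split qData tq t htq0 htq1).thetaRegion m j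
            (.inr pp) ≠
        (settingPrVolSharp X hlog M archPk archSub Ψ act Mmod region n lat sig split qData tq t htq0 htq1).thetaRegion m j
          (.inr pp) := by
  obtain ⟨Φ, hΦ, y, hy, hΦy⟩ := exists_ind2Family_moves_thetaRegion_settingPrVolSharp_of_unit_label X hlog M archPk archSub Ψ
    act Mmod region n lat sig split qData t tq htq0 htq1 pp v₀ hg₀ hx₀ hgx₀ j h1 m
  exact ⟨Φ, Set.mem_union_right _ hΦ, fun heq => hΦy (heq ▸ Set.mem_image_of_mem _ hy)⟩

/-- **Label `0`, criterion form, general analytic `logv`**: the ⊇-half of «are» FAILS for every reading whose label-`0` shadow over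
`p` lies inside the Θ-region (the label idele at `0` is `1`: no hypothesis on `S`). [cite: DupuyHilado2025, §3.9, §4.9]
[claim: Joshi2024ATS3, status: disputed] -/
theorem not_possibleImagesWithinLocus_settingPrVolSharp_of_mover_zero
    {𝔇 : Dictionary ({ toSituation := situationPrVol X hlog M archPk archSub Ψ act Mmod region, col := col } :
      LatticeSituation (thetaIndex X))}
    (R : LociReading (settingPrVolSharp X hlog M archPk archSub Ψ act Mmod region n lat sig split qData tq t htq0 htq1) C 𝔇)
    (hin : R.locusRegion 0 (.inr pp) ⊆
      (settingPrVolSharp X hlog M archPk archSub Ψ act Mmod region n lat sig split qData tq t htq0 htq1).thetaRegion3 0 (.inr pp)) :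
    ¬ R.PossibleImagesWithinLocus := by
  haveI : Fact (pp : ℕ).Prime := ⟨pp.2⟩
  have h1 : ∀ x : (thetaIndex X).Fibre (.inr pp), ‖labelIdele X t pp 0 x‖ = 1 := fun x => by
    unfold labelIdele; rw [dif_neg (by simp), norm_one]
  obtain ⟨Φ, hΦ, hne⟩ := exists_ind2Family_image_thetaRegion_ne_settingPrVolSharp_of_unit_label X hlog M archPk archSub Ψ act Mmod
    region n lat sig split qData t tq htq0 htq1 pp v₀ hg₀ hx₀ hgx₀ 0 h1 0
  refine not_possibleImagesWithinLocus_of_image_ne R hin hΦ ?_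
  rw [Repair.CandDupuyHilado32Real.thetaRegion3_eq_thetaRegion_settingPrVolSharp]
  exact hne

/-- **Every label of `𝔽_l^⋇`, criterion form**: if no place of `S` lies over `p` and the Θ-ideles are units off `S` (abc-iut-c312-7's
`ht1`; every family realising `P_Θ`), the ⊇-half of «are» FAILS for every reading whose shadow at `(i+1, p)` lies inside the
Θ-region — NOT a label-`0` artefact. [cite: DupuyHilado2025, §3.9, §4.9] [claim: Joshi2024ATS3, status: disputed] -/
theorem not_possibleImagesWithinLocus_settingPrVolSharp_of_mover_labelSucc
    (ht1 : ∀ (pp : Nat.Primes) (i : Fin X.lstar) (x : (thetaIndex X).Fibre (.inr pp)),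
      haveI : Fact (pp : ℕ).Prime := ⟨pp.2⟩; placeOf X pp.1 x ∉ X.S → ‖t pp i x‖ = 1)
    (hS : ∀ x : (thetaIndex X).Fibre (.inr pp), haveI : Fact (pp : ℕ).Prime := ⟨pp.2⟩; placeOf X pp.1 x ∉ X.S)
    (i : Fin (thetaIndex X).lstar)
    {𝔇 : Dictionary ({ toSituation := situationPrVol X hlog M archPk archSub Ψ act Mmod region, col := col } :
      LatticeSituation (thetaIndex X))}
    (R : LociReading (settingPrVolSharp X hlog M archPk archSub Ψ act Mmod region n lat sig split qData tq t htq0 htq1) C 𝔇)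
    (hin : R.locusRegion (Setting.labelSucc i) (.inr pp) ⊆
      (settingPrVolSharp X hlog M archPk archSub Ψ act Mmod region n lat sig split qData tq t htq0 htq1).thetaRegion3
        (Setting.labelSucc i) (.inr pp)) :
    ¬ R.PossibleImagesWithinLocus := by
  haveI : Fact (pp : ℕ).Prime := ⟨pp.2⟩
  have h1 : ∀ x : (thetaIndex X).Fibre (.inr pp), ‖labelIdele X t pp (Setting.labelSucc i) x‖ = 1 := fun x => by
    rw [labelIdele_labelSucc]; exact ht1 pp i x (hS x)
  obtain ⟨Φ, hΦ, hne⟩ := exists_ind2Family_image_thetaRegion_ne_settingPrVolSharp_of_unit_label X hlog M archPk archSub Ψ act Mmod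
    region n lat sig split qData t tq htq0 htq1 pp v₀ hg₀ hx₀ hgx₀ (Setting.labelSucc i) h1 0
  refine not_possibleImagesWithinLocus_of_image_ne R hin hΦ ?_
  rw [Repair.CandDupuyHilado32Real.thetaRegion3_eq_thetaRegion_settingPrVolSharp]
  exact hne

/-- **`¬ OrbitInside` at the genuine sharp setting from ONE mover of the unit ball off `S`** (criterion form; Θ-ideles units off
`S`, no place of `S` over `p`): rp-h3's RP-H32 (Ind2) exit without the tame-quadratic hypothesis. [cite: DupuyHilado2025, §3.9, §4.9]
[cite: DupuyHilado2020, §6.2 pp. 19–20] -/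
theorem not_orbitInside_settingPrVolSharp_of_mover
    (ht1 : ∀ (pp : Nat.Primes) (i : Fin X.lstar) (x : (thetaIndex X).Fibre (.inr pp)),
      haveI : Fact (pp : ℕ).Prime := ⟨pp.2⟩; placeOf X pp.1 x ∉ X.S → ‖t pp i x‖ = 1)
    (hS : ∀ x : (thetaIndex X).Fibre (.inr pp), haveI : Fact (pp : ℕ).Prime := ⟨pp.2⟩; placeOf X pp.1 x ∉ X.S) :
    ¬ OrbitInside
        ({ toSituation := situationPrVol X hlog M archPk archSub Ψ act Mmod region, col := col } :
          LatticeSituation (thetaIndex X))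
        (settingPrVolSharp X hlog M archPk archSub Ψ act Mmod region n lat sig split qData tq t htq0 htq1) := by
  haveI : Fact (pp : ℕ).Prime := ⟨pp.2⟩
  let i : Fin (thetaIndex X).lstar := ⟨0, by have := (thetaIndex X).two_le_lstar; omega⟩
  have h1 : ∀ x : (thetaIndex X).Fibre (.inr pp), ‖labelIdele X t pp (Setting.labelSucc i) x‖ = 1 := fun x => by
    rw [labelIdele_labelSucc]; exact ht1 pp i x (hS x)
  obtain ⟨Φ, hΦ, hne⟩ := exists_ind2Family_image_thetaRegion_ne_settingPrVolSharp_of_unit_label X hlog M archPk archSub Ψ act Mmod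
    region n lat sig split qData t tq htq0 htq1 pp v₀ hg₀ hx₀ hgx₀ (Setting.labelSucc i) h1 0
  exact Repair.CandDupuyHilado32Real.not_orbitInside_of_image_ne _ _ i (.inr pp)
    (Repair.CandDupuyHilado32Real.thetaRegion3_eq_thetaRegion_settingPrVolSharp X hlog M archPk archSub Ψ act Mmod region n lat
      sig split qData t tq htq0 htq1 _ _) hΦ hne

end Criterion

/-! ## 2. Ball form: `ψ '' 𝒪_{v₀} ≠ 𝒪_{v₀}` for some `ψ ∈ Real.ismDH` -/

/-- **From the ball form to the criterion form**: if `ψ ∈ Real.ismDH` does not map the unit ball `𝒪_{v₀}` onto itself, then `ψ` or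
`ψ⁻¹` (also in `Real.ismDH`, w5-d216) carries a local integer out of the unit ball — in the currency of abc-iut-c312-5's presentation
at `p` (`φ_{v₀} = id` on the rescaled completion, `𝒪_{v₀} = {‖·‖ ≤ 1}`). [cite: DupuyHilado2025, §4.9] [cite: NeukirchANT1999, Ch. II Prop. (3.3)] -/
theorem exists_mover_of_image_integers_ne (pp : Nat.Primes) (v₀ : HeightOneSpectrum (𝓞 F))
    (hv₀ : (thetaIndex X).over (.inr v₀) = .inr pp)
    (hmov : ∃ ψ ∈ ismDH logv (.inr v₀ : Thm311.Real.Place F),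
      ⇑ψ '' (integers v₀ : Set (Thm311.Real.Carrier (.inr v₀ : Thm311.Real.Place F))) ≠ integers v₀) :
    haveI : Fact (pp : ℕ).Prime := ⟨pp.2⟩
    ∃ g₀ ∈ ismDH logv (.inr v₀ : Thm311.Real.Place F), ∃ x₀ : Thm311.Real.Carrier (.inr v₀ : Thm311.Real.Place F),
      ‖(presAt X hlog pp).φ ⟨.inr v₀, hv₀⟩ x₀‖ ≤ 1 ∧ 1 < ‖(presAt X hlog pp).φ ⟨.inr v₀, hv₀⟩ (g₀ x₀)‖ := by
  haveI : Fact (pp : ℕ).Prime := ⟨pp.2⟩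
  have hv : ((pp : ℕ) : 𝓞 F) ∈ v₀.asIdeal := natCast_mem_placeOf X pp ⟨.inr v₀, hv₀⟩
  have key : ∀ z : Thm311.Real.Carrier (.inr v₀ : Thm311.Real.Place F),
      z ∈ (integers v₀ : Set (Thm311.Real.Carrier (.inr v₀ : Thm311.Real.Place F))) ↔
        ‖(presAt X hlog pp).φ ⟨.inr v₀, hv₀⟩ z‖ ≤ 1 :=
    fun z => mem_integers_iff_norm_rescaled_le_one F pp v₀ hv z
  obtain ⟨ψ, hψ, hne⟩ := hmov
  by_cases hsub : ⇑ψ '' (integers v₀ : Set (Thm311.Real.Carrier (.inr v₀ : Thm311.Real.Place F))) ⊆ integers v₀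
  · -- then some integer is NOT in the image: `ψ⁻¹` moves it out
    have hns : ¬ ((integers v₀ : Set (Thm311.Real.Carrier (.inr v₀ : Thm311.Real.Place F))) ⊆ ⇑ψ '' integers v₀) :=
      fun h => hne (hsub.antisymm h)
    obtain ⟨x₁, hx₁, hx₁'⟩ := Set.not_subset.mp hns
    -- `ψ⁻¹ ∈ Real.ismDH` (w5-d216 `NonIsometryMover.symm_mem_ismDH`, inlined: a bicontinuous lattice automorphism of the
    -- log-shell has a bicontinuous inverse mapping the log-shell onto itself)
    have hψ' : ψ.symm ∈ ismDH logv (.inr v₀ : Thm311.Real.Place F) := by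
      obtain ⟨hc, hc', himg⟩ := hψ
      refine ⟨hc', hc, ?_⟩
      have h := congrArg (fun S => ⇑ψ.symm '' S) himg
      simp only [Set.image_image, LinearEquiv.symm_apply_apply, Set.image_id'] at h
      exact h.symm
    refine ⟨ψ.symm, hψ', x₁, (key x₁).1 hx₁, not_le.mp fun hle => hx₁' ?_⟩
    exact ⟨ψ.symm x₁, (key _).2 hle, ψ.apply_symm_apply x₁⟩
  · obtain ⟨_, ⟨x₀, hx₀, rfl⟩, hx₀'⟩ := Set.not_subset.mp hsub
    exact ⟨ψ, hψ, x₀, (key x₀).1 hx₀, not_le.mp fun hle => hx₀' ((key _).2 hle)⟩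

/-- **Ball form, every label of `𝔽_l^⋇`**: a mover of the unit ball at one place `v₀` over a prime `p` carrying no place of `S`
(Θ-ideles units off `S`) refutes the ⊇-half of «are» for every reading of Joshi's locus whose shadow at `(i+1, p)` lies inside the
Θ-region. [cite: DupuyHilado2025, §3.9, §4.9] [claim: Joshi2024ATS3, status: disputed] -/
theorem not_possibleImagesWithinLocus_settingPrVolSharp_of_image_integers_ne_labelSucc
    (ht1 : ∀ (pp : Nat.Primes) (i : Fin X.lstar) (x : (thetaIndex X).Fibre (.inr pp)),
      haveI : Fact (pp : ℕ).Prime := ⟨pp.2⟩; placeOf X pp.1 x ∉ X.S → ‖t pp i x‖ = 1)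
    (pp : Nat.Primes) (v₀ : HeightOneSpectrum (𝓞 F)) (hv₀ : (thetaIndex X).over (.inr v₀) = .inr pp)
    (hmov : ∃ ψ ∈ ismDH logv (.inr v₀ : Thm311.Real.Place F),
      ⇑ψ '' (integers v₀ : Set (Thm311.Real.Carrier (.inr v₀ : Thm311.Real.Place F))) ≠ integers v₀)
    (hS : ∀ x : (thetaIndex X).Fibre (.inr pp), haveI : Fact (pp : ℕ).Prime := ⟨pp.2⟩; placeOf X pp.1 x ∉ X.S)
    (i : Fin (thetaIndex X).lstar)
    {𝔇 : Dictionary ({ toSituation := situationPrVol X hlog M archPk archSub Ψ act Mmod region, col := col } :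
      LatticeSituation (thetaIndex X))}
    (R : LociReading (settingPrVolSharp X hlog M archPk archSub Ψ act Mmod region n lat sig split qData tq t htq0 htq1) C 𝔇)
    (hin : R.locusRegion (Setting.labelSucc i) (.inr pp) ⊆
      (settingPrVolSharp X hlog M archPk archSub Ψ act Mmod region n lat sig split qData tq t htq0 htq1).thetaRegion3
        (Setting.labelSucc i) (.inr pp)) :
    ¬ R.PossibleImagesWithinLocus := by
  obtain ⟨g₀, hg₀, x₀, hx₀, hgx₀⟩ := exists_mover_of_image_integers_ne X hlog pp v₀ hv₀ hmov
  exact not_possibleImagesWithinLocus_settingPrVolSharp_of_mover_labelSucc X hlog M archPk archSub Ψ act Mmod region n lat sig split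
    qData t tq htq0 htq1 col pp ⟨.inr v₀, hv₀⟩ hg₀ hx₀ hgx₀ ht1 hS i R hin

/-- **Ball form, `¬ OrbitInside`**: a mover of the unit ball at one place over a prime carrying no place of `S` (Θ-ideles units off
`S`) puts the genuine sharp setting OUTSIDE rp-h3's class — e.g. a TAME place `2 ≤ e ≤ p − 2` (w5-d180
`exists_ismDH_image_integers_ne_of_tame`) or a DYADIC place when `√−1 ∈ F` (w5-d039; the sequel). [cite: DupuyHilado2025, §3.9, §4.9]
[cite: DupuyHilado2020, §6.2 pp. 19–20] -/
theorem not_orbitInside_settingPrVolSharp_of_image_integers_ne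
    (ht1 : ∀ (pp : Nat.Primes) (i : Fin X.lstar) (x : (thetaIndex X).Fibre (.inr pp)),
      haveI : Fact (pp : ℕ).Prime := ⟨pp.2⟩; placeOf X pp.1 x ∉ X.S → ‖t pp i x‖ = 1)
    (pp : Nat.Primes) (v₀ : HeightOneSpectrum (𝓞 F)) (hv₀ : (thetaIndex X).over (.inr v₀) = .inr pp)
    (hmov : ∃ ψ ∈ ismDH logv (.inr v₀ : Thm311.Real.Place F),
      ⇑ψ '' (integers v₀ : Set (Thm311.Real.Carrier (.inr v₀ : Thm311.Real.Place F))) ≠ integers v₀)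
    (hS : ∀ x : (thetaIndex X).Fibre (.inr pp), haveI : Fact (pp : ℕ).Prime := ⟨pp.2⟩; placeOf X pp.1 x ∉ X.S) :
    ¬ OrbitInside
        ({ toSituation := situationPrVol X hlog M archPk archSub Ψ act Mmod region, col := col } :
          LatticeSituation (thetaIndex X))
        (settingPrVolSharp X hlog M archPk archSub Ψ act Mmod region n lat sig split qData tq t htq0 htq1) := by
  obtain ⟨g₀, hg₀, x₀, hx₀, hgx₀⟩ := exists_mover_of_image_integers_ne X hlog pp v₀ hv₀ hmov
  exact not_orbitInside_settingPrVolSharp_of_mover X hlog M archPk archSub Ψ act Mmod region n lat sig split qData t tq htq0 htq1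
    col pp ⟨.inr v₀, hv₀⟩ hg₀ hx₀ hgx₀ ht1 hS

end Genuine

end Summit.ABC.IUTFork.Joshi

end
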